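import Summits.ResolutionOfSingularities.ResolutionOfSingularities.Theorems.WeightedInvariantGradedSimpleOrbitCharts
import Summits.ResolutionOfSingularities.ResolutionOfSingularities.Theorems.WeightedInvariantELadderOneDisjoint
import Mathlib.RingTheory.GradedAlgebra.Homogeneous.Ideal
import Mathlib.RingTheory.Nakayama
import HarnessLib

/-!
# Homogeneous parameters at the generic point of a closed orbit generate its prime along the whole orbit

Route `ResolutionOfSingularities/WeightedInvariant`, door crux `HypersurfaceCentreConstruction`
(stmt-ResolutionOfSingularities-19897) — OURS, helper; e-ladder `e = 1`, registered stub `stub_e1_centre` of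
`res-L1-w43-stub-10` (cell res-hironaka, `D/res-D-pv-025/DOOR-ELADDER-PLAN.md` §7, L0-charts, item **(L0-T)**
«independence of homogeneous sections propagates along a graded-simple orbit closure», part 1 of 2).

SETTING.  `W` an affine open of a scheme `Y` with a grading `𝒜` of `Γ(Y, W)` by an abelian group (a torus chart),
`η ∈ W` a point whose prime `P = 𝔭_η ⊆ Γ(Y, W)` is HOMOGENEOUS with GRADED-SIMPLE quotient (every homogeneous
section outside `P` is a unit modulo `P`: `V(P) ∩ W = closure {η} ∩ W` is a closed orbit with finite stabilisers),
and `f₀, …, f_{n-1} ∈ P` HOMOGENEOUS sections whose germs generate `𝔪_η ⊆ 𝒪_{Y,η}` (e.g. two sections with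
independent differentials when `𝒪_{Y,η}` is regular of dimension `2`,
`span_pair_eq_maximalIdeal_of_linearIndependent`; such homogeneous `f` exist by
`exists_homogeneous_orbitChartParameters`).  CONCLUSION (`map_primeIdealOf_eq_span_germ_of_mem_closure`): at EVERY
point `y ∈ V(P) ∩ W` the germs of the `fᵢ` generate the extended prime, `(f)·𝒪_{Y,y} = 𝔭_η·𝒪_{Y,y}` — with no
hypothesis at `y`.  (Part 2 adds: `𝒪_{Y,y}/𝔭_η 𝒪_{Y,y}` is regular, hence the `fᵢ` have independent differentials
at `y` when `Y` is regular.)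

PROOF — graded Nakayama over a graded-simple quotient (pure ideal algebra, §1–§2):
* §1 `isHomogeneous_colon_singleton`: the colon `(I : x)` of a homogeneous ideal by a homogeneous element is
  homogeneous (the components of `a·x` are the `aₘ·x`, `DirectSum.coe_decompose_mul_add_of_right_mem`);
* §1 `le_of_forall_exists_mul_mem_of_gradedSimple`: if `P` is homogeneous with graded-simple quotient, `I` is
  homogeneous with `P·P ≤ I`, and every `x ∈ P` has a multiplier `s ∉ P` with `s·x ∈ I`, then `P ≤ I` — for
  homogeneous `x ∈ P` the colon `(I : x)` is a homogeneous ideal containing `P` and some `s ∉ P`, hence `= ⊤` by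
  `eq_or_eq_top_of_isHomogeneous_of_gradedSimple` (res-type-047), and `P` is generated by homogeneous elements;
* §2 `map_eq_map_of_le_mul_sup` — local Nakayama: `P ≤ P·P ⊔ J` with `J ≤ P` finitely generated gives
  `P·S = J·S` in every localisation `S` at a prime `Q ⊇ P` (indeed in any local `S` in which `P` becomes
  non-unit: `Submodule.le_of_le_smul_of_le_jacobson_bot`);
* §3 the chart: `𝔭_η ≤ 𝔭_η² ⊔ (f)` (`primeIdealOf_le_sq_sup_span`: the multipliers come from
  `(f)·𝒪_{Y,η} = 𝔪_η`, cleared of denominators by `IsLocalization.algebraMap_mem_map_algebraMap_iff`), whence the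
  conclusion at every `y ∈ W` with `𝔭_η ≤ 𝔭_y`, i.e. `y ∈ closure {η}` (`primeIdealOf_le_of_mem_closure`).

Def-free; no named facts; nothing here is a claim about Hironaka's problem.  AI-written; weaker than expert review.
-/

noncomputable section

set_option linter.dupNamespace false -- mandated namespace of this single-conjunct summit

open CategoryTheory AlgebraicGeometry TopologicalSpace IsLocalRing
open Literature.AlgebraicGeometry.Resolution

namespace Summit.ResolutionOfSingularities.ResolutionOfSingularities.Theorems

universe u

/-! ## §1 Graded Nakayama over a graded-simple quotient -/

section Graded

variable {ι σ A : Type*} [CommRing A] [DecidableEq ι] [AddCommGroup ι] [SetLike σ A]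
  [AddSubmonoidClass σ A] (𝒜 : ι → σ) [GradedRing 𝒜]

/-- **The colon of a homogeneous ideal by a homogeneous element is homogeneous**: if `a·x ∈ I` with `x` of
degree `d`, then the degree-`(m + d)` component of `a·x` is `aₘ·x ∈ I`. [folklore] -/
theorem isHomogeneous_colon_singleton {I : Ideal A} (hI : I.IsHomogeneous 𝒜) {x : A} {d : ι}
    (hx : x ∈ 𝒜 d) : (I.colon ({x} : Set A)).IsHomogeneous 𝒜 := by
  intro m a ha
  rw [Submodule.mem_colon_singleton, smul_eq_mul] at ha ⊢
  have h := hI (m + d) ha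
  rwa [DirectSum.coe_decompose_mul_add_of_right_mem 𝒜 hx] at h

/-- **Graded Nakayama over a graded-simple quotient.**  Let `P` be a homogeneous ideal with graded-simple
quotient (every homogeneous element outside `P` is a unit modulo `P`), `I` a homogeneous ideal with `P·P ≤ I`,
and suppose every `x ∈ P` admits `s ∉ P` with `s·x ∈ I` («`P ≤ I` generically along `V(P)`»).  Then `P ≤ I`.
[folklore] -/
theorem le_of_forall_exists_mul_mem_of_gradedSimple {P I : Ideal A}
    (hP : ∀ (i : ι) ⦃a : A⦄, a ∈ 𝒜 i → a ∉ P → IsUnit (Ideal.Quotient.mk P a))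
    (hPhom : P.IsHomogeneous 𝒜) (hI : I.IsHomogeneous 𝒜) (hPPI : P * P ≤ I)
    (hgen : ∀ x ∈ P, ∃ s ∉ P, s * x ∈ I) : P ≤ I := by
  classical
  -- homogeneous elements of `P` lie in `I`
  have hhom : ∀ (d : ι) (x : A), x ∈ 𝒜 d → x ∈ P → x ∈ I := by
    intro d x hxd hxP
    set J : Ideal A := I.colon ({x} : Set A) with hJdef
    have hJhom : J.IsHomogeneous 𝒜 := isHomogeneous_colon_singleton 𝒜 hI hxd
    have hPJ : P ≤ J := fun a ha => by
      rw [hJdef, Submodule.mem_colon_singleton, smul_eq_mul]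
      exact hPPI (Ideal.mul_mem_mul ha hxP)
    obtain ⟨s, hsP, hsx⟩ := hgen x hxP
    have hsJ : s ∈ J := by
      rw [hJdef, Submodule.mem_colon_singleton, smul_eq_mul]
      exact hsx
    rcases eq_or_eq_top_of_isHomogeneous_of_gradedSimple 𝒜 hP hJhom hPJ with hJP | hJtop
    · exact absurd (hJP ▸ hsJ) hsP
    · have h1 : (1 : A) ∈ J := hJtop ▸ Submodule.mem_top
      rw [hJdef, Submodule.mem_colon_singleton, smul_eq_mul, one_mul] at h1
      exact h1
  -- `P` is generated by its homogeneous elements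
  intro x hxP
  rw [← DirectSum.sum_support_decompose 𝒜 x]
  exact I.sum_mem fun i _ => hhom i _ (SetLike.coe_mem _) (hPhom i hxP)

/-- The ideal `P·P ⊔ (f)` is homogeneous for `P` homogeneous and `f` a family of homogeneous elements.
[folklore] -/
theorem isHomogeneous_mul_sup_span_range {P : Ideal A} (hPhom : P.IsHomogeneous 𝒜) {n : ℕ} {f : Fin n → A}
    {d : Fin n → ι} (hf : ∀ i, f i ∈ 𝒜 (d i)) : (P * P ⊔ Ideal.span (Set.range f)).IsHomogeneous 𝒜 :=
  (hPhom.mul hPhom).sup (Ideal.homogeneous_span 𝒜 _ (by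
    rintro _ ⟨i, rfl⟩
    exact ⟨d i, hf i⟩))

/-- **Graded Nakayama, parameters form**: `P` homogeneous with graded-simple quotient, `f` homogeneous
elements of `P` such that every `x ∈ P` has `s ∉ P` with `s·x ∈ (f)`; then `P ≤ P·P ⊔ (f)`. [folklore] -/
theorem le_mul_sup_span_of_gradedSimple {P : Ideal A}
    (hP : ∀ (i : ι) ⦃a : A⦄, a ∈ 𝒜 i → a ∉ P → IsUnit (Ideal.Quotient.mk P a))
    (hPhom : P.IsHomogeneous 𝒜) {n : ℕ} {f : Fin n → A} {d : Fin n → ι} (hf : ∀ i, f i ∈ 𝒜 (d i))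
    (hgen : ∀ x ∈ P, ∃ s ∉ P, s * x ∈ Ideal.span (Set.range f)) :
    P ≤ P * P ⊔ Ideal.span (Set.range f) :=
  le_of_forall_exists_mul_mem_of_gradedSimple 𝒜 hP hPhom (isHomogeneous_mul_sup_span_range 𝒜 hPhom hf)
    le_sup_left fun x hx => by
      obtain ⟨s, hs, hsx⟩ := hgen x hx
      exact ⟨s, hs, Ideal.mem_sup_right hsx⟩

end Graded

/-! ## §2 Local Nakayama: `P ≤ P·P ⊔ J` forces `P·S = J·S` at the points of `V(P)` -/

section Nakayama

variable {A : Type*} [CommRing A] {S : Type*} [CommRing S] [Algebra A S] [IsLocalRing S]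

/-- **Local Nakayama.**  If `P ≤ P·P ⊔ J` with `J ≤ P`, `P` finitely generated, and `P` extends into the
maximal ideal of the local `A`-algebra `S` (e.g. `S = A_Q`, `Q ⊇ P`), then `P·S = J·S`. [folklore] -/
theorem map_eq_map_of_le_mul_sup {P J : Ideal A} (hPfg : P.FG) (hJP : J ≤ P) (hle : P ≤ P * P ⊔ J)
    (hPS : P.map (algebraMap A S) ≤ maximalIdeal S) :
    P.map (algebraMap A S) = J.map (algebraMap A S) := by
  refine le_antisymm ?_ (Ideal.map_mono hJP)
  have hfg : (P.map (algebraMap A S)).FG := hPfg.map _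
  refine Submodule.le_of_le_smul_of_le_jacobson_bot hfg (IsLocalRing.maximalIdeal_le_jacobson _) ?_
  calc P.map (algebraMap A S) ≤ (P * P ⊔ J).map (algebraMap A S) := Ideal.map_mono hle
    _ = P.map (algebraMap A S) * P.map (algebraMap A S) ⊔ J.map (algebraMap A S) := by
        rw [Ideal.map_sup, Ideal.map_mul]
    _ ≤ maximalIdeal S • P.map (algebraMap A S) ⊔ J.map (algebraMap A S) := by
        rw [Ideal.smul_eq_mul]
        exact sup_le_sup_right (Ideal.mul_mono_left hPS) _
    _ = J.map (algebraMap A S) ⊔ maximalIdeal S • P.map (algebraMap A S) := sup_comm _ _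

end Nakayama

/-! ## §3 On the chart: `𝔭_η ≤ 𝔭_η² ⊔ (f)` and `(f)·𝒪_{Y,y} = 𝔭_η·𝒪_{Y,y}` along `V(𝔭_η)` -/

section Chart

variable {Y : Scheme.{u}} (W : Y.affineOpens) {ι : Type*} [DecidableEq ι] [AddCommGroup ι]
  (𝒜 : ι → AddSubgroup Γ(Y, W)) [GradedRing 𝒜] {η : Y} (hηW : η ∈ (W : Y.Opens))

/-- **Multipliers from the generic point.**  If the germs at `η` of sections `f₀, …, f_{n-1}` generate `𝔪_η`,
then every `x ∈ 𝔭_η` has a multiplier `s ∉ 𝔭_η` with `s·x ∈ (f)` in `Γ(Y, W)` (`𝒪_{Y,η}` is the localisation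
of `Γ(Y, W)` at `𝔭_η`). [folklore] -/
theorem exists_mul_mem_span_of_span_germ_eq {n : ℕ} (f : Fin n → Γ(Y, W))
    (hspan : Ideal.span (Set.range fun i => (Y.presheaf.germ (W : Y.Opens) η hηW).hom (f i)) =
      maximalIdeal (Y.presheaf.stalk η))
    {x : Γ(Y, W)} (hx : x ∈ (W.2.primeIdealOf ⟨η, hηW⟩).asIdeal) :
    ∃ s ∉ (W.2.primeIdealOf ⟨η, hηW⟩).asIdeal, s * x ∈ Ideal.span (Set.range f) := by
  letI : Algebra Γ(Y, W) (Y.presheaf.stalk η) := TopCat.Presheaf.algebra_section_stalk Y.presheaf ⟨η, hηW⟩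
  have hloc : IsLocalization.AtPrime (Y.presheaf.stalk η) (W.2.primeIdealOf ⟨η, hηW⟩).asIdeal :=
    W.2.isLocalization_stalk ⟨η, hηW⟩
  have hgerm : ∀ s : Γ(Y, W), algebraMap Γ(Y, W) (Y.presheaf.stalk η) s =
      (Y.presheaf.germ (W : Y.Opens) η hηW).hom s := fun _ => rfl
  -- `germ x ∈ 𝔪_η = (germ f) = (f)·𝒪_{Y,η}`
  have hxm : algebraMap Γ(Y, W) (Y.presheaf.stalk η) x ∈
      (Ideal.span (Set.range f)).map (algebraMap Γ(Y, W) (Y.presheaf.stalk η)) := by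
    rw [Ideal.map_span, ← Set.range_comp]
    change _ ∈ Ideal.span (Set.range fun i => algebraMap Γ(Y, W) (Y.presheaf.stalk η) (f i))
    simp_rw [hgerm]
    rw [hspan]
    exact (germ_mem_maximalIdeal_iff_mem_primeIdealOf W hηW x).mpr hx
  obtain ⟨s, hs, hsx⟩ :=
    (IsLocalization.algebraMap_mem_map_algebraMap_iff (W.2.primeIdealOf ⟨η, hηW⟩).asIdeal.primeCompl
      (Y.presheaf.stalk η) (Ideal.span (Set.range f)) x).mp hxm
  exact ⟨s, hs, hsx⟩

/-- **`𝔭_η ≤ 𝔭_η² ⊔ (f)`** for homogeneous sections `f₀, …, f_{n-1} ∈ Γ(Y, W)` whose germs generate `𝔪_η`,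
`𝔭_η` being homogeneous with graded-simple quotient (graded Nakayama, `le_mul_sup_span_of_gradedSimple`).
[folklore] -/
theorem primeIdealOf_le_sq_sup_span
    (hPhom : ((W.2.primeIdealOf ⟨η, hηW⟩).asIdeal).IsHomogeneous 𝒜)
    (hsimple : ∀ (d : ι) (x : Γ(Y, W)), x ∈ 𝒜 d → x ∉ (W.2.primeIdealOf ⟨η, hηW⟩).asIdeal →
      IsUnit (Ideal.Quotient.mk (W.2.primeIdealOf ⟨η, hηW⟩).asIdeal x))
    {n : ℕ} (f : Fin n → Γ(Y, W)) {d : Fin n → ι} (hf : ∀ i, f i ∈ 𝒜 (d i))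
    (hspan : Ideal.span (Set.range fun i => (Y.presheaf.germ (W : Y.Opens) η hηW).hom (f i)) =
      maximalIdeal (Y.presheaf.stalk η)) :
    (W.2.primeIdealOf ⟨η, hηW⟩).asIdeal ≤
      (W.2.primeIdealOf ⟨η, hηW⟩).asIdeal * (W.2.primeIdealOf ⟨η, hηW⟩).asIdeal ⊔ Ideal.span (Set.range f) :=
  le_mul_sup_span_of_gradedSimple 𝒜 (fun i _ ha haP => hsimple i _ ha haP) hPhom hf
    fun _ hx => exists_mul_mem_span_of_span_germ_eq W hηW f hspan hx

/-- The `fᵢ` lie in `𝔭_η` when their germs generate `𝔪_η`. [folklore] -/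
theorem mem_primeIdealOf_of_span_germ_eq {n : ℕ} (f : Fin n → Γ(Y, W))
    (hspan : Ideal.span (Set.range fun i => (Y.presheaf.germ (W : Y.Opens) η hηW).hom (f i)) =
      maximalIdeal (Y.presheaf.stalk η)) (i : Fin n) :
    f i ∈ (W.2.primeIdealOf ⟨η, hηW⟩).asIdeal := by
  rw [← germ_mem_maximalIdeal_iff_mem_primeIdealOf W hηW, ← hspan]
  exact Ideal.subset_span ⟨i, rfl⟩

variable [IsLocallyNoetherian Y]

/-- **`(f)·𝒪_{Y,y} = 𝔭_η·𝒪_{Y,y}` at every point of the orbit closure in the chart.**  With `𝔭_η`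
homogeneous and graded-simple and homogeneous `f₀, …, f_{n-1}` whose germs generate `𝔪_η`: for every `y ∈ W`
in `closure {η}`, the germs of the `fᵢ` at `y` generate the extension of `𝔭_η` to `𝒪_{Y,y}` (graded Nakayama
§1 + local Nakayama §2 in `𝒪_{Y,y} = Γ(Y, W)_{𝔭_y}`, `𝔭_η ≤ 𝔭_y`). [folklore] -/
theorem map_primeIdealOf_eq_span_germ_of_mem_closure
    (hPhom : ((W.2.primeIdealOf ⟨η, hηW⟩).asIdeal).IsHomogeneous 𝒜)
    (hsimple : ∀ (d : ι) (x : Γ(Y, W)), x ∈ 𝒜 d → x ∉ (W.2.primeIdealOf ⟨η, hηW⟩).asIdeal →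
      IsUnit (Ideal.Quotient.mk (W.2.primeIdealOf ⟨η, hηW⟩).asIdeal x))
    {n : ℕ} (f : Fin n → Γ(Y, W)) {d : Fin n → ι} (hf : ∀ i, f i ∈ 𝒜 (d i))
    (hspan : Ideal.span (Set.range fun i => (Y.presheaf.germ (W : Y.Opens) η hηW).hom (f i)) =
      maximalIdeal (Y.presheaf.stalk η))
    {y : Y} (hyW : y ∈ (W : Y.Opens)) (hy : y ∈ closure ({η} : Set Y)) :
    ((W.2.primeIdealOf ⟨η, hηW⟩).asIdeal).map (Y.presheaf.germ (W : Y.Opens) y hyW).hom =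
      Ideal.span (Set.range fun i => (Y.presheaf.germ (W : Y.Opens) y hyW).hom (f i)) := by
  letI : Algebra Γ(Y, W) (Y.presheaf.stalk y) := TopCat.Presheaf.algebra_section_stalk Y.presheaf ⟨y, hyW⟩
  have hloc : IsLocalization.AtPrime (Y.presheaf.stalk y) (W.2.primeIdealOf ⟨y, hyW⟩).asIdeal :=
    W.2.isLocalization_stalk ⟨y, hyW⟩
  have hgerm : (Y.presheaf.germ (W : Y.Opens) y hyW).hom = algebraMap Γ(Y, W) (Y.presheaf.stalk y) := rfl
  haveI : IsNoetherianRing Γ(Y, W) := IsLocallyNoetherian.component_noetherian W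
  have hPy : (W.2.primeIdealOf ⟨η, hηW⟩).asIdeal ≤ (W.2.primeIdealOf ⟨y, hyW⟩).asIdeal :=
    primeIdealOf_le_of_mem_closure W hηW hyW hy
  have hPS : ((W.2.primeIdealOf ⟨η, hηW⟩).asIdeal).map (algebraMap Γ(Y, W) (Y.presheaf.stalk y)) ≤
      maximalIdeal (Y.presheaf.stalk y) := by
    rw [← IsLocalization.AtPrime.map_eq_maximalIdeal (W.2.primeIdealOf ⟨y, hyW⟩).asIdeal
      (Y.presheaf.stalk y)]
    exact Ideal.map_mono hPy
  have hJP : Ideal.span (Set.range f) ≤ (W.2.primeIdealOf ⟨η, hηW⟩).asIdeal :=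
    Ideal.span_le.mpr (Set.range_subset_iff.mpr (mem_primeIdealOf_of_span_germ_eq W hηW f hspan))
  rw [hgerm, map_eq_map_of_le_mul_sup (IsNoetherian.noetherian _) hJP
    (primeIdealOf_le_sq_sup_span W 𝒜 hηW hPhom hsimple f hf hspan) hPS, Ideal.map_span, ← Set.range_comp]
  rfl

/-- **Stalk form**: the extended prime `𝔭_η·𝒪_{Y,y}` is the `stalkIdeal` of the reduced ideal sheaf of the
orbit closure only up to the chart dictionary; here we record the version part 2 consumes: at `y ∈ W ∩
closure {η}`, `(f)·𝒪_{Y,y} ⊇ (germ of every section of 𝔭_η)`. [folklore] -/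
theorem germ_mem_span_germ_of_mem_primeIdealOf
    (hPhom : ((W.2.primeIdealOf ⟨η, hηW⟩).asIdeal).IsHomogeneous 𝒜)
    (hsimple : ∀ (d : ι) (x : Γ(Y, W)), x ∈ 𝒜 d → x ∉ (W.2.primeIdealOf ⟨η, hηW⟩).asIdeal →
      IsUnit (Ideal.Quotient.mk (W.2.primeIdealOf ⟨η, hηW⟩).asIdeal x))
    {n : ℕ} (f : Fin n → Γ(Y, W)) {d : Fin n → ι} (hf : ∀ i, f i ∈ 𝒜 (d i))
    (hspan : Ideal.span (Set.range fun i => (Y.presheaf.germ (W : Y.Opens) η hηW).hom (f i)) =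
      maximalIdeal (Y.presheaf.stalk η))
    {y : Y} (hyW : y ∈ (W : Y.Opens)) (hy : y ∈ closure ({η} : Set Y))
    {x : Γ(Y, W)} (hx : x ∈ (W.2.primeIdealOf ⟨η, hηW⟩).asIdeal) :
    (Y.presheaf.germ (W : Y.Opens) y hyW).hom x ∈
      Ideal.span (Set.range fun i => (Y.presheaf.germ (W : Y.Opens) y hyW).hom (f i)) := by
  rw [← map_primeIdealOf_eq_span_germ_of_mem_closure W 𝒜 hηW hPhom hsimple f hf hspan hyW hy]
  exact Ideal.mem_map_of_mem _ hx

end Chart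

end Summit.ResolutionOfSingularities.ResolutionOfSingularities.Theorems

end
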